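import Mathlib.RingTheory.MvPolynomial.Symmetric.Defs
import Mathlib.LinearAlgebra.Vandermonde
import Mathlib.LinearAlgebra.Matrix.NonsingularInverse
import Literature.Computability.AlgebraicComplexity.FormulaUnfolding
import Literature.Computability.AlgebraicComplexity.MS21DenseOrbitsHittingSets
import Literature.Computability.AlgebraicComplexity.CKSV22FormulaComplexityBridge
import HarnessLib

/-!
# Ben-Or's interpolation formula for the elementary symmetric polynomials: `E(e_{n,d}) = O(n²)`

Topic `Literature/Computability/AlgebraicComplexity`; companion (upper-bound side) of the CKSV 2022
formula lower bound `formulaComplexity_esymm_lower_bound` (`CKSV22FormulaComplexityBridge.lean`: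
`(n − (d−2))·⌊d/3⌋ ≤ 2·(E(e_{n,d}) + 1)`, CKSV Theorem 3 in the tree's currency `formulaComplexity`).

P. Chatterjee, M. Kumar, A. She, B. L. Volk, *Quadratic lower bounds for algebraic branching programs
and formulas*, comput. complex. **31** (2022) 8 (arXiv:1911.11793), §1 (held arXiv text
`paper:arxiv-1911.11793` p0002.txt, abstract continuation): "This lower bound also matches the upper
bound, due to Ben-Or, who showed that elementary symmetric polynomials can be computed by algebraic
formula (in fact depth-3 formula) of size `O(n²)`", and §1.3 (p0007.txt region, TeX L173): "due to a
well known observation of Ben-Or, [the elementary symmetric polynomials] are also known to be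
computable by a formula (in fact, a depth-3 formula) of size `O(n²)` over all large enough fields."

**Ben-Or's construction** (folklore; M. Ben-Or, unpublished, as reported in Nisan–Wigderson 1996 §1
and Shpilka–Wigderson 2001): `∏_{i<n} (x_i + t) = Σ_k e_k(x) t^{n−k}` is a polynomial of degree `n`
in `t`; evaluating at `n + 1` distinct field elements `a_0, …, a_n` and inverting the Vandermonde
matrix expresses each `e_k` as a linear combination `Σ_j c_j ∏_i (x_i + a_j)` — a `ΣΠΣ` formula with
`n + 1` product gates of fan-in `n`.

## Contents (theorem-only; no definitions, no named facts)

* `BenOr.sum_C_mul_prod_X_add_C` — the interpolation identity (Vandermonde coefficients)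
  `Σ_j C(c_j) · ∏_i (X i + C a_j) = esymm (Fin n) K k`;
* `BenOr.exists_esymm_eq_sum_prod_affine` — existence form over any field with `n + 1` distinct
  elements (`Function.Injective a`), and `…_of_infinite`;
* `BenOr.isSPS_esymm` (v2) — the printed depth-3 reading in the tree's currency `MS2021.IsSPS`
  (Medini–Shpilka Def 4, `Σ^{[s]}Π^{[d]}Σ`): **`e_{n,k} ∈ Σ^{[n+1]}Π^{[n+1]}Σ`** over any field with
  `n + 1` distinct elements — "over any field of size `|𝔽| ≥ n+1`, `σ_d` has a `ΣΠΣ` circuit of size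
  `O(n²)`" (held text p0034.txt:L24–26); product gate `j` = the `n` affine forms `x_i + a_j` and the
  constant form `c_j`;
* `BenOr.formulaComplexity_esymm_two_sided` (v3) — the NAMED two-sided statement
  `(n − (d−2))·⌊d/3⌋ ≤ 2·(E(e_{n,d}) + 1) ∧ E(e_{n,d}) ≤ 2(n+1)²` over an infinite field in which
  `1, …, n ≠ 0` (∧ of `CKSV2022.formulaComplexity_esymm_lower_bound` and the Ben-Or bound), and
  `BenOr.exists_cksvFormula_esymm_size_le` — the upper bound in CKSV's own `Formula.size` currency
  (`≤ 2(n+1)² + 1` variable leaves, via `CKSV2022.exists_formula_size_le`);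
* `BenOr.formulaComplexity_esymm_le` — **`E(e_{n,k}) ≤ 2·(n+1)²`** in the tree's fan-in-two gate
  count `formulaComplexity` (each affine factor one weighted-sum gate, `n − 1` product gates per
  product, one scalar gate and one addition per summand), over any field with `n + 1` distinct
  elements; `…_of_infinite` for infinite fields (e.g. characteristic zero).

With `formulaComplexity_esymm_lower_bound` (CKSV Thm. 3) this makes `E(e_{n,⌊n/10⌋}) = Θ(n²)` a
two-sided statement of the tree (the lower bound needs `1, …, n ≠ 0` in `K`, the upper bound `n + 1`
distinct elements). Honest framing: an upper bound for a test polynomial; it documents that the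
quadratic formula lower bound is tight for `e_{n,d}` and says nothing about `VP` vs `VNP`.

## References
* [ChatterjeeKumarSheVolk2022] — §1 (abstract continuation; §1.3 "Formulas"), Theorem 3.
* N. Nisan, A. Wigderson, *Lower bounds on arithmetic circuits via partial derivatives*,
  Comput. Complexity 6 (1996/97), §1 (Ben-Or's depth-3 formula for the symmetric polynomials).
  [NisanWigderson1996]
* A. Shpilka, A. Wigderson, *Depth-3 arithmetic circuits over fields of characteristic zero*,
  Comput. Complexity 10 (2001) (optimality of Ben-Or's construction in depth 3). [ShpilkaWigderson2001]
* D. Medini, A. Shpilka, *Hitting sets and reconstruction for dense orbits in VP_e and ΣΠΣ circuits*,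
  CCC 2021 = arXiv:2102.05632, §6 proof of Thm 42 (held text p0034.txt:L24–26): "over any field of
  size `|𝔽| ≥ n+1`, `σ_d` has a `ΣΠΣ` circuit of size `O(n²)` …, that is obtained by interpolating
  `∏(Y + x_i)`" — the printed locator for the identity (the tree's `MS21SigmaPiAffStrictWitness.lean`
  formalises the same interpolation for `e_k(x_1², …, x_n²)`). [MediniShpilka2021]
-/

noncomputable section

open MvPolynomial Matrix Finset

namespace Literature.Computability.AlgebraicComplexity

namespace BenOr

universe u

variable {K : Type u} [Field K]

/-! ### Interpolation coefficients (Vandermonde) -/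

/-- Lagrange coefficients: for `N` distinct nodes `a_j` and a target exponent `e₀ < N` there are
`c_j` with `∑_j c_j a_j^e = [e = e₀]` for all `e < N` (row `e₀` of the inverse Vandermonde matrix;
same statement as `MS2021.Thm42Strict.exists_interpolation_coeffs`, restated privately to keep the
import cone small). [folklore] -/
private theorem exists_interpolation_coeffs {N : ℕ} (a : Fin N → K) (ha : Function.Injective a)
    (e₀ : Fin N) :
    ∃ c : Fin N → K, ∀ e : Fin N, ∑ j, c j * a j ^ (e : ℕ) = if e = e₀ then 1 else 0 := by
  classical
  have hV : IsUnit (Matrix.vandermonde a).det :=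
    isUnit_iff_ne_zero.mpr (Matrix.det_vandermonde_ne_zero_iff.mpr ha)
  refine ⟨Matrix.vecMul (Pi.single e₀ 1) (Matrix.vandermonde a)⁻¹, fun e => ?_⟩
  have h := congrFun (Matrix.vecMul_vecMul (Pi.single e₀ (1 : K)) (Matrix.vandermonde a)⁻¹
    (Matrix.vandermonde a)) e
  rw [Matrix.nonsing_inv_mul _ hV, Matrix.vecMul_one, Pi.single_apply] at h
  rw [← h]
  simp [Matrix.vecMul, dotProduct, Matrix.vandermonde_apply]

/-! ### Ben-Or's identity -/

/-- `∏_{i<n} (x_i + t) = ∑_{T ⊆ [n]} (∏_{i ∈ T} x_i) · t^{n − |T|}`. [folklore] -/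
private theorem prod_X_add_C {n : ℕ} (t : K) :
    ∏ i : Fin n, ((X i : MvPolynomial (Fin n) K) + C t) =
      ∑ T ∈ (Finset.univ : Finset (Fin n)).powerset,
        (∏ i ∈ T, (X i : MvPolynomial (Fin n) K)) * C (t ^ (n - T.card)) := by
  classical
  rw [Finset.prod_add]
  refine Finset.sum_congr rfl fun T hT => ?_
  rw [Finset.prod_const, Finset.card_sdiff_of_subset (Finset.mem_powerset.mp hT), Finset.card_univ,
    Fintype.card_fin, C_pow]

/-- **Ben-Or's interpolation identity**: with Lagrange coefficients `c` for the nodes `t_j` and the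
target exponent `n − k`, `∑_j c_j ∏_i (x_i + t_j) = e_k(x_1, …, x_n)` ("`σ_d` has a `ΣΠΣ` circuit
of size `O(n²)` … obtained by interpolating `∏ (Y + x_i)`", Medini–Shpilka; Ben-Or's construction as
quoted by CKSV §1). [cite: MediniShpilka2021, §6 proof of Thm 42 (arXiv p0034:L24-L26)]
[cite: ChatterjeeKumarSheVolk2022, §1 (Ben-Or's upper bound, p0002)] -/
theorem sum_C_mul_prod_X_add_C {n k : ℕ} (hk : k ≤ n) (t c : Fin (n + 1) → K)
    (hc : ∀ e : Fin (n + 1), ∑ j, c j * t j ^ (e : ℕ) = if e = ⟨n - k, by omega⟩ then 1 else 0) :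
    ∑ j : Fin (n + 1), C (c j) * ∏ i : Fin n, ((X i : MvPolynomial (Fin n) K) + C (t j)) =
      esymm (Fin n) K k := by
  classical
  rw [esymm]
  simp_rw [prod_X_add_C, Finset.mul_sum]
  rw [Finset.sum_comm]
  have key : ∀ T ∈ (Finset.univ : Finset (Fin n)).powerset,
      ∑ j : Fin (n + 1), C (c j) * ((∏ i ∈ T, (X i : MvPolynomial (Fin n) K)) *
        C (t j ^ (n - T.card))) =
      if T.card = k then ∏ i ∈ T, (X i : MvPolynomial (Fin n) K) else 0 := by
    intro T hT
    have hTn : T.card ≤ n := by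
      simpa using Finset.card_le_card (Finset.mem_powerset.mp hT)
    have hsum : ∑ j : Fin (n + 1), C (c j) * ((∏ i ∈ T, (X i : MvPolynomial (Fin n) K)) *
        C (t j ^ (n - T.card))) =
        (∏ i ∈ T, (X i : MvPolynomial (Fin n) K)) *
          C (∑ j : Fin (n + 1), c j * t j ^ (n - T.card)) := by
      rw [map_sum, Finset.mul_sum]
      refine Finset.sum_congr rfl fun j _ => ?_
      rw [map_mul]
      ring
    rw [hsum]
    have hc' := hc ⟨n - T.card, by omega⟩
    simp only [Fin.mk.injEq] at hc'
    rw [hc']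
    by_cases hTk : T.card = k
    · rw [if_pos (by omega), if_pos hTk, map_one, mul_one]
    · rw [if_neg (by omega), if_neg hTk, map_zero, mul_zero]
  rw [Finset.sum_congr rfl key, ← Finset.sum_filter, Finset.powersetCard_eq_filter]

/-- **Ben-Or's `ΣΠΣ` formula** (existence form): over a field with `n + 1` distinct elements
`a_0, …, a_n`, every `e_k(x_1, …, x_n)` (`k ≤ n`) is a linear combination of the `n + 1` products
`∏_i (x_i + a_j)` ("over any field of size `|𝔽| ≥ n + 1`", Medini–Shpilka loc. cit.).
[cite: MediniShpilka2021, §6 proof of Thm 42 (arXiv p0034:L24-L26)]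
[cite: ChatterjeeKumarSheVolk2022, §1 (Ben-Or's upper bound)] -/
theorem exists_esymm_eq_sum_prod_affine {n k : ℕ} (hk : k ≤ n) (a : Fin (n + 1) → K)
    (ha : Function.Injective a) :
    ∃ c : Fin (n + 1) → K, esymm (Fin n) K k =
      ∑ j : Fin (n + 1), C (c j) * ∏ i : Fin n, ((X i : MvPolynomial (Fin n) K) + C (a j)) := by
  obtain ⟨c, hc⟩ := exists_interpolation_coeffs a ha ⟨n - k, by omega⟩
  exact ⟨c, (sum_C_mul_prod_X_add_C hk a c hc).symm⟩

/-! ### Gate counts in the tree's currency `formulaComplexity` -/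

section Size

variable {k : Type u} [CommSemiring k] {σ : Type*}

/-- `E(C c) = 0`. [folklore] -/
private theorem formulaComplexity_C_le (c : k) : formulaComplexity (C c : MvPolynomial σ k) ≤ 0 :=
  (exists_wexpr_iff_formulaComplexity_le _ 0).mp ⟨.const c, by simp, by simp⟩

/-- `E(X i) = 0`. [folklore] -/
private theorem formulaComplexity_X_le (i : σ) : formulaComplexity (X i : MvPolynomial σ k) ≤ 0 :=
  (exists_wexpr_iff_formulaComplexity_le _ 0).mp ⟨.var i, by simp, by simp⟩

/-- `E(X i + C c) ≤ 1` (one weighted-sum gate `1·X_i + c·1`). [folklore] -/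
private theorem formulaComplexity_X_add_C_le (i : σ) (c : k) :
    formulaComplexity ((X i : MvPolynomial σ k) + C c) ≤ 1 :=
  (exists_wexpr_iff_formulaComplexity_le _ 1).mp
    ⟨.lin 1 (.var i) c (.const 1), by simp [smul_eq_C_mul], by simp⟩

/-- Products: `E(∏_{i ∈ s} u_i) ≤ ∑_{i ∈ s} (E(u_i) + 1)`. [folklore] -/
private theorem formulaComplexity_finset_prod_le {ι : Type*} (s : Finset ι) (u : ι → MvPolynomial σ k) :
    formulaComplexity (∏ i ∈ s, u i) ≤ ∑ i ∈ s, (formulaComplexity (u i) + 1) := by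
  classical
  induction s using Finset.induction_on with
  | empty =>
    rw [Finset.prod_empty, Finset.sum_empty, ← C_1]
    exact formulaComplexity_C_le 1
  | insert a s ha ih =>
    rw [Finset.prod_insert ha, Finset.sum_insert ha]
    refine (formulaComplexity_mul_le _ _).trans ?_
    omega

/-- Sums: `E(∑_{i ∈ s} u_i) ≤ ∑_{i ∈ s} (E(u_i) + 1)`. [folklore] -/
private theorem formulaComplexity_finset_sum_le' {ι : Type*} (s : Finset ι) (u : ι → MvPolynomial σ k) :
    formulaComplexity (∑ i ∈ s, u i) ≤ ∑ i ∈ s, (formulaComplexity (u i) + 1) := by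
  classical
  induction s using Finset.induction_on with
  | empty =>
    rw [Finset.sum_empty, Finset.sum_empty, ← C_0]
    exact formulaComplexity_C_le 0
  | insert a s ha ih =>
    rw [Finset.sum_insert ha, Finset.sum_insert ha]
    refine (formulaComplexity_add_le _ _).trans ?_
    omega

end Size

/-- One Ben-Or product gate: `E(∏_{i<n} (x_i + t)) ≤ 2n` (the `n` affine forms and `n − 1`
products of one product gate of the `ΣΠΣ` circuit). [cite: MediniShpilka2021, §6 proof of Thm 42 (arXiv p0034:L24-L26)] -/
theorem formulaComplexity_prod_X_add_C_le {n : ℕ} (t : K) :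
    formulaComplexity (∏ i : Fin n, ((X i : MvPolynomial (Fin n) K) + C t)) ≤ 2 * n := by
  refine (formulaComplexity_finset_prod_le _ _).trans ?_
  calc ∑ i : Fin n, (formulaComplexity ((X i : MvPolynomial (Fin n) K) + C t) + 1)
      ≤ ∑ _i : Fin n, 2 := Finset.sum_le_sum fun i _ => by
        have := formulaComplexity_X_add_C_le (k := K) (σ := Fin n) i t; omega
    _ = 2 * n := by simp [mul_comm]

/-- **Ben-Or: `E(e_{n,k}) ≤ 2 (n+1)²`** over any field with `n + 1` distinct elements — the
`O(n²)` formula (indeed `ΣΠΣ`) upper bound quoted by CKSV 2022 §1 as matching their Theorem 3.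
(For `k > n`, `e_{n,k} = 0`.) [cite: ChatterjeeKumarSheVolk2022, §1 (Ben-Or's upper bound, p0002)]
[cite: MediniShpilka2021, §6 proof of Thm 42 (arXiv p0034:L24-L26)] -/
theorem formulaComplexity_esymm_le {n : ℕ} (a : Fin (n + 1) → K) (ha : Function.Injective a)
    (k : ℕ) : formulaComplexity (esymm (Fin n) K k) ≤ 2 * (n + 1) ^ 2 := by
  classical
  by_cases hk : k ≤ n
  · obtain ⟨c, hc⟩ := exists_esymm_eq_sum_prod_affine hk a ha
    rw [hc]
    refine (formulaComplexity_finset_sum_le' _ _).trans ?_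
    calc ∑ j : Fin (n + 1), (formulaComplexity
            (C (c j) * ∏ i : Fin n, ((X i : MvPolynomial (Fin n) K) + C (a j))) + 1)
        ≤ ∑ _j : Fin (n + 1), (2 * n + 2) := Finset.sum_le_sum fun j _ => by
          have h1 := formulaComplexity_mul_le (C (c j))
            (∏ i : Fin n, ((X i : MvPolynomial (Fin n) K) + C (a j)))
          have h2 := formulaComplexity_C_le (σ := Fin n) (c j)
          have h3 := formulaComplexity_prod_X_add_C_le (n := n) (a j)
          omega
      _ = (n + 1) * (2 * n + 2) := by simp
      _ = 2 * (n + 1) ^ 2 := by ring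
  · have h0 : esymm (Fin n) K k = 0 := by
      rw [esymm, Finset.powersetCard_eq_empty.mpr (by simpa using not_le.mp hk), Finset.sum_empty]
    rw [h0, ← C_0]
    exact (formulaComplexity_C_le (σ := Fin n) (0 : K)).trans (Nat.zero_le _)

/-- **Ben-Or over an infinite field** (in particular in characteristic zero): `E(e_{n,k}) ≤ 2(n+1)²`.
[cite: ChatterjeeKumarSheVolk2022, §1 (Ben-Or's upper bound, "over all large enough fields")] -/
theorem formulaComplexity_esymm_le_of_infinite [Infinite K] (n k : ℕ) :
    formulaComplexity (esymm (Fin n) K k) ≤ 2 * (n + 1) ^ 2 :=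
  formulaComplexity_esymm_le (fun j : Fin (n + 1) => Infinite.natEmbedding K (j : ℕ))
    (fun _ _ h => Fin.ext ((Infinite.natEmbedding K).injective h)) k

/-! ### The depth-3 reading: `e_{n,k} ∈ Σ^{[n+1]}Π^{[n+1]}Σ` (v2) -/

/-- The affine form with coefficient vector "indicator of `i`" and constant `e` is `x_i + e`. [folklore] -/
private theorem affine_form_single {n : ℕ} (i : Fin n) (e : K) :
    (C e + ∑ m : Fin n, C (if m = i then (1 : K) else 0) * (X m : MvPolynomial (Fin n) K)) =
      X i + C e := by
  classical
  have h : ∀ m : Fin n, C (if m = i then (1 : K) else 0) * (X m : MvPolynomial (Fin n) K) =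
      if m = i then X m else 0 := fun m => by
    split_ifs <;> simp
  simp_rw [h]
  rw [Finset.sum_ite_eq' Finset.univ i, if_pos (Finset.mem_univ i), add_comm]

/-- **Ben-Or's `ΣΠΣ` circuit for `e_{n,k}` in the currency `MS2021.IsSPS`** (Medini–Shpilka, Def 4:
`Σ^{[s]}Π^{[d]}Σ` circuits "compute polynomials of the form `Σ_i ∏_j (α_{i,j,0} + Σ_k α_{i,j,k} x_k)`"):
over a field with `n + 1` distinct elements `a_0, …, a_n`, `e_k(x_1, …, x_n)` is computed by a
`Σ^{[n+1]}Π^{[n+1]}Σ` circuit — `n + 1` product gates, gate `j` multiplying the `n` affine forms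
`x_i + a_j` and the constant form `c_j` ("over any field of size `|𝔽| ≥ n+1`, `σ_d` has a `ΣΠΣ`
circuit of size `O(n²)` …, that is obtained by interpolating `∏ (Y + x_i)`"). For `k > n` the
polynomial is `0` and the circuit with all forms `0` computes it.
[cite: MediniShpilka2021, §6 proof of Thm 42 (arXiv p0034:L24-L26) and Def 4 (arXiv Def 1.4, p0005:L25-30)]
[cite: ChatterjeeKumarSheVolk2022, §1 (Ben-Or's depth-3 formula of size O(n²))] -/
theorem isSPS_esymm {n : ℕ} (a : Fin (n + 1) → K) (ha : Function.Injective a) (k : ℕ) :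
    MS2021.IsSPS (n + 1) (n + 1) (esymm (Fin n) K k) := by
  classical
  by_cases hk : k ≤ n
  · obtain ⟨c, hc⟩ := exists_esymm_eq_sum_prod_affine hk a ha
    -- coefficient vectors: factor `l < n` of gate `j` is `x_l + a_j`, the last factor is `c_j`
    let α : Fin (n + 1) → Fin (n + 1) → Option (Fin n) → K := fun j l =>
      if h : (l : ℕ) < n then fun o => o.elim (a j) fun m => if m = ⟨l, h⟩ then 1 else 0
      else fun o => o.elim (c j) fun _ => 0
    refine ⟨α, ?_⟩
    rw [hc]
    refine Finset.sum_congr rfl fun j _ => ?_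
    rw [Fin.prod_univ_castSucc]
    have h1 : ∀ i : Fin n, (C (α j (Fin.castSucc i) none) +
        ∑ m : Fin n, C (α j (Fin.castSucc i) (some m)) * (X m : MvPolynomial (Fin n) K))
        = X i + C (a j) := by
      intro i
      have hi : ((Fin.castSucc i : Fin (n + 1)) : ℕ) < n := by simp
      have hα0 : α j (Fin.castSucc i) none = a j := by
        simp only [α, dif_pos hi, Option.elim]
      have hα1 : ∀ m : Fin n, α j (Fin.castSucc i) (some m) = if m = i then 1 else 0 := by
        intro m
        simp only [α, dif_pos hi, Option.elim]
        simp [Fin.ext_iff]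
      simp_rw [hα0, hα1]
      rw [affine_form_single]
    have h2 : (C (α j (Fin.last n) none) +
        ∑ m : Fin n, C (α j (Fin.last n) (some m)) * (X m : MvPolynomial (Fin n) K)) = C (c j) := by
      have hi : ¬ ((Fin.last n : Fin (n + 1)) : ℕ) < n := by simp
      have hα0 : α j (Fin.last n) none = c j := by
        simp only [α, dif_neg hi, Option.elim]
      have hα1 : ∀ m : Fin n, α j (Fin.last n) (some m) = 0 := by
        intro m
        simp only [α, dif_neg hi, Option.elim]
      simp_rw [hα0, hα1]
      simp
    simp_rw [h1]
    rw [h2, mul_comm]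
  · have h0 : esymm (Fin n) K k = 0 := by
      rw [esymm, Finset.powersetCard_eq_empty.mpr (by simpa using not_le.mp hk), Finset.sum_empty]
    refine ⟨fun _ _ _ => 0, ?_⟩
    rw [h0]
    symm
    refine Finset.sum_eq_zero fun j _ => ?_
    rw [Fin.prod_univ_castSucc]
    simp

/-- The same over an infinite field (e.g. characteristic zero): `e_{n,k} ∈ Σ^{[n+1]}Π^{[n+1]}Σ`.
[cite: MediniShpilka2021, §6 proof of Thm 42 (arXiv p0034:L24-L26)] -/
theorem isSPS_esymm_of_infinite [Infinite K] (n k : ℕ) :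
    MS2021.IsSPS (n + 1) (n + 1) (esymm (Fin n) K k) :=
  isSPS_esymm (fun j : Fin (n + 1) => Infinite.natEmbedding K (j : ℕ))
    (fun _ _ h => Fin.ext ((Infinite.natEmbedding K).injective h)) k

/-! ### The two-sided statement (v3): CKSV Thm 3 is tight on its own witness -/

/-- **`E(e_{n,d}) = Θ(n²)` for `d = Θ(n)`, two-sidedly in the tree's currency `formulaComplexity`**:
for `3 ≤ d ≤ n` over an infinite field in which `1, …, n` are non-zero,
`(n − (d−2))·⌊d/3⌋ ≤ 2·(E(e_{n,d}) + 1)` (CKSV 2022 Thm 3, tree: `CKSV2022.formulaComplexity_esymm_lower_bound`)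
and `E(e_{n,d}) ≤ 2(n+1)²` (Ben-Or, `formulaComplexity_esymm_le_of_infinite`). Record-class: the
quadratic formula lower bound is tight on CKSV's own witness ("matches the upper bound, due to
Ben-Or"). [cite: ChatterjeeKumarSheVolk2022, Theorem 3 and §1 (Ben-Or's matching upper bound, p0002)] -/
theorem formulaComplexity_esymm_two_sided [Infinite K] {n d : ℕ} (hd : 3 ≤ d) (hdn : d ≤ n)
    (hK : ∀ j : ℕ, 1 ≤ j → j ≤ n → (j : K) ≠ 0) :
    (n - (d - 2)) * (d / 3) ≤ 2 * (formulaComplexity (esymm (Fin n) K d) + 1) ∧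
      formulaComplexity (esymm (Fin n) K d) ≤ 2 * (n + 1) ^ 2 :=
  ⟨CKSV2022.formulaComplexity_esymm_lower_bound hd hdn hK, formulaComplexity_esymm_le_of_infinite n d⟩

/-- **Ben-Or's bound in CKSV's own size currency** (`CKSV2022.Formula.size` = number of variable
leaves, §5.2): over a field with `n + 1` distinct elements some CKSV formula computes `e_{n,k}` with
at most `2(n+1)² + 1` variable leaves (`CKSV2022.exists_formula_size_le`: `size ≤ E + 1`). Compare
`CKSV2022.chatterjeeKumarSheVolk2022_thm_3` (`(n − (d−2))·⌊d/3⌋ ≤ 2·size`).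
[cite: ChatterjeeKumarSheVolk2022, §1 (Ben-Or's matching upper bound) and §5.2 (size of a formula, L800)] -/
theorem exists_cksvFormula_esymm_size_le {n : ℕ} (a : Fin (n + 1) → K) (ha : Function.Injective a)
    (k : ℕ) : ∃ Φ : CKSV2022.Formula n K, Φ.eval = esymm (Fin n) K k ∧ Φ.size ≤ 2 * (n + 1) ^ 2 + 1 := by
  obtain ⟨Φ, hΦ, hs⟩ := CKSV2022.exists_formula_size_le (esymm (Fin n) K k)
  exact ⟨Φ, hΦ, hs.trans (Nat.add_le_add_right (formulaComplexity_esymm_le a ha k) 1)⟩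

/-- The same over an infinite field. [cite: ChatterjeeKumarSheVolk2022, §1 (Ben-Or's matching upper bound) and §5.2] -/
theorem exists_cksvFormula_esymm_size_le_of_infinite [Infinite K] (n k : ℕ) :
    ∃ Φ : CKSV2022.Formula n K, Φ.eval = esymm (Fin n) K k ∧ Φ.size ≤ 2 * (n + 1) ^ 2 + 1 :=
  exists_cksvFormula_esymm_size_le (fun j : Fin (n + 1) => Infinite.natEmbedding K (j : ℕ))
    (fun _ _ h => Fin.ext ((Infinite.natEmbedding K).injective h)) k

end BenOr

end Literature.Computability.AlgebraicComplexity

end
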